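import Summits.ValiantsHypothesis.ValiantsHypothesis.Theorems.KPlusLogSqLawTropicalBLongRangeAtomsLinked

/-!
# Route «KPlusLogSqLaw», crux `TropicalB` (stmt-ValiantsHypothesis-19771) — THE STRADDLE LAW and the SUNFLOWER LAW AT THE ENDS OF A CHAIN:
# two dominant terms never deviate from an earlier (or later) dominant term on disjoint column sets

HONEST FRAMING.  Part 3 of the long-range atom laws (seat val-sym-trop-p1 g21, cell `pub-symmetroid`, 2026-08-28; `--supports
stmt-ValiantsHypothesis-19771 --as helper`).  A STRUCTURE law valid for EVERY dominance design at every format — no hypothesis on exponents,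
valuations, support, signs, and (unlike parts 1–2) NO tightness hypothesis.  Nothing here bounds `TropicalB` in its window or bears on
`WeakLifting`, DoorA26 / DoorA34, `MatrixDescartes` (stmt-ValiantsHypothesis-18050) or VP ≠ VNP.

THE LAWS.  For terms `P, C` write `Δ(P, C)` for the set of columns where they differ (in row or in class).
* `straddle` — **STRADDLE LAW**: if `P, C, R` are dominant terms of one design (at integer slopes `θ_P, θ_C, θ_R`), `P ≠ C ≠ R`, and the
  deviations `Δ(P, C)` and `Δ(C, R)` are DISJOINT, then `C` lies STRICTLY BETWEEN `P` and `R`: `θ_P < θ_C < θ_R` or `θ_R < θ_C < θ_P`.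
  (Reason: `C` is then the hybrid «`R` on `Δ(P,C)`, `P` elsewhere» of the pair `(P, R)` along an invariant block of `σ_P⁻¹σ_R`
  (`split_of_disjoint_changes`, part 2), so its slope lies strictly between theirs by the hybrid law (`AtomBudget.exists_present_slope_between`),
  while slopes of dominant terms increase with the parameter.)
* `sunflower_after` / `sunflower_before` / `sunflower_after_alt` — **SUNFLOWER LAW AT AN EXTREME TERM**: along a dominant chain, the deviation sets `Δ(p_i, p_j)`, `j > i`,
  of all LATER terms from a fixed term `p_i` are PAIRWISE INTERSECTING; likewise the deviations of all EARLIER terms.  In particular the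
  deviations of every dominant term from the first term of the chain (e.g. a corner term `(σ, l…l)`) pairwise meet.
* `single_deviation_column` — consequence: two later terms that each deviate from `p_i` in ONE column deviate in the SAME column.
LOCATED CHECK (seat folder py/sunflower.py): on the kernel's counting-tight `(5,4)` chain (…TropicalCensusFiveFourTight, 56 terms) the deviation sets
from every term `p_i` of two terms on the SAME side of `p_i` intersect in all 55 440 instances, while deviations on OPPOSITE sides of a term are
disjoint 155 times (of 27 720) — the one-sidedness in the law is real; moreover every one of the 55 deviations from the corner term `p_0` contains
the columns `1` and `3`, and any two of them share at least two columns.  [exchange argument: folklore; the packaging is this cell's, no citation exists]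
-/

set_option linter.dupNamespace false
set_option autoImplicit false

namespace Summit.ValiantsHypothesis.ValiantsHypothesis.Theorems.KPlusLogSqLaw.LongRangeAtom

open Summit.ValiantsHypothesis.ValiantsHypothesis.Theorems.MatrixDescartes.Negative
open Summit.ValiantsHypothesis.ValiantsHypothesis.Theorems.LacunarySymmetroidMatrixDescartes
open Summit.ValiantsHypothesis.ValiantsHypothesis.Theorems.LacunarySymmetroidMatrixDescartes.TropicalCensus
open Summit.ValiantsHypothesis.ValiantsHypothesis.Theorems.KPlusLogSqLaw.Sumset
open Summit.ValiantsHypothesis.ValiantsHypothesis.Theorems.KPlusLogSqLaw.AtomBudget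
open scoped BigOperators
open Finset

variable {m K : ℕ}

/-! ## 1. The straddle law -/

/-- two distinct terms cannot both be dominant at the same slope. [folklore] -/
theorem theta_ne_of_dominant (d : Fin K → ℕ) (v ε : Fin m → Fin m → Fin K → ℤ) {θ₁ θ₂ : ℤ}
    {p q : Equiv.Perm (Fin m) × (Fin m → Fin K)} (hp : IsDominant d v ε θ₁ p) (hq : IsDominant d v ε θ₂ q) (hne : p ≠ q) :
    θ₁ ≠ θ₂ := by
  rintro rfl
  have h1 := hp.2 q (Ne.symm hne) hq.1
  have h2 := hq.2 p hne hp.1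
  exact lt_asymm h1 h2

/-- ordered core of the straddle law: with `θ_P < θ_R`, disjoint deviations force `θ_P < θ_C < θ_R`. -/
theorem straddle_of_lt (d : Fin K → ℕ) (v ε : Fin m → Fin m → Fin K → ℤ) {θP θC θR : ℤ}
    {P C R : Equiv.Perm (Fin m) × (Fin m → Fin K)}
    (hP : IsDominant d v ε θP P) (hC : IsDominant d v ε θC C) (hR : IsDominant d v ε θR R) (hPR : θP < θR)
    (hPC : P ≠ C) (hCR : C ≠ R)
    (hdisj : ∀ b, (P.1 b ≠ C.1 b ∨ P.2 b ≠ C.2 b) → ¬ (C.1 b ≠ R.1 b ∨ C.2 b ≠ R.2 b)) :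
    θP < θC ∧ θC < θR := by
  classical
  obtain ⟨hT, hin, hout⟩ := split_of_disjoint_changes P C R hdisj hPC hCR
  obtain ⟨r, -, hrT, hrT', h₁, h₂⟩ := exists_present_slope_between d v ε hPR hP hR _ hT hin hout
  -- the hybrid `r` has the classes of `C` everywhere, hence the slope of `C`
  have hCT : ∀ b ∈ (univ.filter fun b => P.1 b ≠ C.1 b ∨ P.2 b ≠ C.2 b), C.1 b = R.1 b ∧ C.2 b = R.2 b := by
    intro b hb
    have h := hdisj b ((mem_changeSet_iff P C b).mp hb)
    push Not at h
    exact h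
  have hCT' : ∀ b ∉ (univ.filter fun b => P.1 b ≠ C.1 b ∨ P.2 b ≠ C.2 b), C.1 b = P.1 b ∧ C.2 b = P.2 b := by
    intro b hb
    have h : ¬ (P.1 b ≠ C.1 b ∨ P.2 b ≠ C.2 b) := fun h' => hb ((mem_changeSet_iff P C b).mpr h')
    push Not at h
    exact ⟨h.1.symm, h.2.symm⟩
  have hsr : TropicalCensus.slope d r = TropicalCensus.slope d C := by
    rw [slope_hybrid d P R r _ hrT hrT', slope_hybrid d P R C _ hCT hCT']
  rw [hsr] at h₁ h₂
  -- compare with the parameter order of dominant terms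
  constructor
  · by_contra hle
    push Not at hle
    rcases hle.lt_or_eq with hlt | heq
    · exact lt_asymm h₁ (slope_lt_of_dominant d v ε hlt (Ne.symm hPC) hC hP)
    · exact theta_ne_of_dominant d v ε hC hP (Ne.symm hPC) heq
  · by_contra hle
    push Not at hle
    rcases hle.lt_or_eq with hlt | heq
    · exact lt_asymm h₂ (slope_lt_of_dominant d v ε hlt (Ne.symm hCR) hR hC)
    · exact theta_ne_of_dominant d v ε hR hC (Ne.symm hCR) heq

/-- **STRADDLE LAW.**  Let `P, C, R` be dominant terms of one design with `P ≠ C`, `C ≠ R`, whose deviations `Δ(P,C)` and `Δ(C,R)` are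
disjoint (no column changes both from `P` to `C` and from `C` to `R`).  Then `C` lies strictly between `P` and `R` in the parameter:
`θ_P < θ_C < θ_R` or `θ_R < θ_C < θ_P`.  Equivalently: two dominant terms never deviate from an EARLIER (or from a LATER) dominant term on
disjoint column sets. [exchange argument; this packaging is the cell's] -/
theorem straddle (d : Fin K → ℕ) (v ε : Fin m → Fin m → Fin K → ℤ) {θP θC θR : ℤ}
    {P C R : Equiv.Perm (Fin m) × (Fin m → Fin K)}
    (hP : IsDominant d v ε θP P) (hC : IsDominant d v ε θC C) (hR : IsDominant d v ε θR R)
    (hPC : P ≠ C) (hCR : C ≠ R)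
    (hdisj : ∀ b, (P.1 b ≠ C.1 b ∨ P.2 b ≠ C.2 b) → ¬ (C.1 b ≠ R.1 b ∨ C.2 b ≠ R.2 b)) :
    (θP < θC ∧ θC < θR) ∨ (θR < θC ∧ θC < θP) := by
  -- `P ≠ R`: otherwise `Δ(P,C) = Δ(C,R)` would be disjoint from itself, i.e. empty
  have hPRne : P ≠ R := by
    rintro rfl
    apply hPC
    have hall : ∀ b, P.1 b = C.1 b ∧ P.2 b = C.2 b := by
      intro b
      by_contra h
      rw [not_and_or] at h
      have h' : P.1 b ≠ C.1 b ∨ P.2 b ≠ C.2 b := h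
      exact hdisj b h' (by rcases h' with h1 | h1 <;> [exact Or.inl (Ne.symm h1); exact Or.inr (Ne.symm h1)])
    exact Prod.ext (Equiv.ext fun b => (hall b).1) (funext fun b => (hall b).2)
  rcases lt_trichotomy θP θR with hlt | heq | hgt
  · exact Or.inl (straddle_of_lt d v ε hP hC hR hlt hPC hCR hdisj)
  · exact absurd heq (theta_ne_of_dominant d v ε hP hR hPRne)
  · refine Or.inr (straddle_of_lt d v ε hR hC hP hgt (Ne.symm hCR) (Ne.symm hPC) fun b hb h2 => ?_)
    refine hdisj b ?_ ?_
    · rcases h2 with h | h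
      · exact Or.inl (Ne.symm h)
      · exact Or.inr (Ne.symm h)
    · rcases hb with h | h
      · exact Or.inl (Ne.symm h)
      · exact Or.inr (Ne.symm h)

/-! ## 2. The sunflower law at an extreme term of a chain -/

section Chain

variable (d : Fin K → ℕ) (v ε : Fin m → Fin m → Fin K → ℤ) {n : ℕ}
  (θ : Fin (n + 1) → ℤ) (p : Fin (n + 1) → Equiv.Perm (Fin m) × (Fin m → Fin K))

/-- **SUNFLOWER LAW (later terms).**  Along a dominant chain at strictly increasing slopes (distinct consecutive terms), the deviations of two
LATER terms `p_j`, `p_k` (`i < j`, `i < k`; for `j = k` this just says `p_j ≠ p_i`) from `p_i` share a column. [this cell] -/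
theorem sunflower_after (hθ : StrictMono θ) (hdom : ∀ k, IsDominant d v ε (θ k) (p k))
    (hne : ∀ k : Fin n, p k.castSucc ≠ p k.succ)
    {i j k : Fin (n + 1)} (hij : i < j) (hik : i < k) :
    ∃ b : Fin m, ((p i).1 b ≠ (p j).1 b ∨ (p i).2 b ≠ (p j).2 b) ∧ ((p i).1 b ≠ (p k).1 b ∨ (p i).2 b ≠ (p k).2 b) := by
  by_contra hcon
  push Not at hcon
  have hsm := slope_strictMono d v ε θ p hθ hdom hne
  have hdist : ∀ {a b : Fin (n + 1)}, a < b → p a ≠ p b := fun hab heq => (hsm hab).ne (by simp only [heq])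
  have hdisj : ∀ b, ((p j).1 b ≠ (p i).1 b ∨ (p j).2 b ≠ (p i).2 b) →
      ¬ ((p i).1 b ≠ (p k).1 b ∨ (p i).2 b ≠ (p k).2 b) := by
    intro b hb h2
    have hb' : (p i).1 b ≠ (p j).1 b ∨ (p i).2 b ≠ (p j).2 b := by
      rcases hb with h | h
      · exact Or.inl (Ne.symm h)
      · exact Or.inr (Ne.symm h)
    have := hcon b hb'
    rcases h2 with h | h
    · exact h this.1
    · exact h this.2
  rcases straddle d v ε (hdom j) (hdom i) (hdom k) (hdist hij).symm (hdist hik) hdisj with ⟨h1, -⟩ | ⟨h2, -⟩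
  · exact lt_asymm h1 (hθ hij)
  · exact lt_asymm h2 (hθ hik)

/-- **SUNFLOWER LAW (earlier terms).**  The deviations of two EARLIER terms `p_j`, `p_k` (`j < i`, `k < i`) from `p_i` share a column. [this cell] -/
theorem sunflower_before (hθ : StrictMono θ) (hdom : ∀ k, IsDominant d v ε (θ k) (p k))
    (hne : ∀ k : Fin n, p k.castSucc ≠ p k.succ)
    {i j k : Fin (n + 1)} (hji : j < i) (hki : k < i) :
    ∃ b : Fin m, ((p i).1 b ≠ (p j).1 b ∨ (p i).2 b ≠ (p j).2 b) ∧ ((p i).1 b ≠ (p k).1 b ∨ (p i).2 b ≠ (p k).2 b) := by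
  by_contra hcon
  push Not at hcon
  have hsm := slope_strictMono d v ε θ p hθ hdom hne
  have hdist : ∀ {a b : Fin (n + 1)}, a < b → p a ≠ p b := fun hab heq => (hsm hab).ne (by simp only [heq])
  have hdisj : ∀ b, ((p j).1 b ≠ (p i).1 b ∨ (p j).2 b ≠ (p i).2 b) →
      ¬ ((p i).1 b ≠ (p k).1 b ∨ (p i).2 b ≠ (p k).2 b) := by
    intro b hb h2
    have hb' : (p i).1 b ≠ (p j).1 b ∨ (p i).2 b ≠ (p j).2 b := by
      rcases hb with h | h
      · exact Or.inl (Ne.symm h)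
      · exact Or.inr (Ne.symm h)
    have := hcon b hb'
    rcases h2 with h | h
    · exact h this.1
    · exact h this.2
  rcases straddle d v ε (hdom j) (hdom i) (hdom k) (hdist hji) (hdist hki).symm hdisj with ⟨-, h2⟩ | ⟨-, h1⟩
  · exact lt_asymm h2 (hθ hki)
  · exact lt_asymm h1 (hθ hji)

/-- **single-column deviations agree**: if two later terms each deviate from `p_i` in at most one column (`b₁` resp. `b₂`),
then `b₁ = b₂` — all one-cell deviations from an extreme term sit at the same column. [this cell] -/
theorem single_deviation_column (hθ : StrictMono θ) (hdom : ∀ k, IsDominant d v ε (θ k) (p k))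
    (hne : ∀ k : Fin n, p k.castSucc ≠ p k.succ)
    {i j k : Fin (n + 1)} (hij : i < j) (hik : i < k) {b₁ b₂ : Fin m}
    (h₁ : ∀ b, ((p i).1 b ≠ (p j).1 b ∨ (p i).2 b ≠ (p j).2 b) → b = b₁)
    (h₂ : ∀ b, ((p i).1 b ≠ (p k).1 b ∨ (p i).2 b ≠ (p k).2 b) → b = b₂) : b₁ = b₂ := by
  obtain ⟨b, hbj, hbk⟩ := sunflower_after d v ε θ p hθ hdom hne hij hik
  rw [← h₁ b hbj, ← h₂ b hbk]

/-- **sunflower law, signed hypotheses of `TropRow`** (alternating signs give distinct consecutive terms). [this cell] -/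
theorem sunflower_after_alt (hθ : StrictMono θ) (hdom : ∀ k, IsDominant d v ε (θ k) (p k))
    (halt : ∀ k : Fin n, termSign ε (p k.castSucc) * termSign ε (p k.succ) < 0)
    {i j k : Fin (n + 1)} (hij : i < j) (hik : i < k) :
    ∃ b : Fin m, ((p i).1 b ≠ (p j).1 b ∨ (p i).2 b ≠ (p j).2 b) ∧ ((p i).1 b ≠ (p k).1 b ∨ (p i).2 b ≠ (p k).2 b) :=
  sunflower_after d v ε θ p hθ hdom (ne_succ_of_alternating ε p halt) hij hik

end Chain

end Summit.ValiantsHypothesis.ValiantsHypothesis.Theorems.KPlusLogSqLaw.LongRangeAtom
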